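import Mathlib
import Summits.Ventures.DiscreteObjects.Mahler.MahlerDerivativeBound
import Summits.Ventures.DiscreteObjects.Mahler.FewnomialSupport
import Summits.Ventures.DiscreteObjects.Mahler.SubLehmerDegree56
import Literature.NumberTheory.MahlerMeasure.FewMonomials

/-!
# The fewnomial height bounds `|c_j| ≤ binom(k-1, j) · M(f)` and `M(f) ≥ h(f)/2^{k-2}` (venture `DiscreteObjects`, target L)

Cell `pub-namedobj`, seat `pub-namedobj-mahler-g26`. Framing: lottery ticket; floor = certified bounds/negative ranges.

**Theorem** (`norm_coeff_le_choose_mul_mahlerMeasure`; [cite: AkhtariVaaler2019, Theorem 1.1] = [cite: MckeeSmyth2021,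
Theorem 11.4], improving [cite: DobrowolskiSmyth2017, Theorem 1]).  Let `f = c_0 z^{m_0} + ⋯ + c_{k-1} z^{m_{k-1}} ∈ ℂ[z]` have
exactly `k` nonzero coefficients, listed by increasing exponent.  Then `|c_j| ≤ binom(k-1, j) · M(f)` for every `j`
— in Lean, for `i ∈ supp f` with RANK `j = #{e ∈ supp f : e < i}`.  Since `binom(k-1, j) ≤ 2^{k-2}` this contains
the Dobrowolski–Smyth bound `|c_j| ≤ 2^{k-2} M(f)`, i.e. `M(f) ≥ h(f)/2^{k-2}` (`norm_coeff_le_two_pow_mul_mahlerMeasure`).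
REPLICATION in the kernel of the printed proof (McKee–Smyth §11.2): strip the power of `z` dividing `f`; induction on
`k`; for a middle coefficient, `i |c_i| ≤ binom(k-2, j-1) · deg f · M(f)` from `f'` and `(deg f - i) |c_i| ≤
binom(k-2, j) · deg f · M(f)` from the derivative of the reversed polynomial, by MAHLER'S INEQUALITY `M(f') ≤ deg f · M(f)`
(`mahlerMeasure_derivative_le`, file `MahlerDerivativeBound`) and `M(reverse f) = M(f)`; add (Pascal's rule).

Consequences. `fewnomialHeightMahlerBound_holds` DISCHARGES the Literature named fact
`Literature.NumberTheory.MahlerMeasure.FewnomialHeightMahlerBound` (integer case of [DobrowolskiSmyth2017, Thm 1]).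
Census reading (target L): a sub-Lehmer integer polynomial (`1 < M(P) < M(ℓ) = 1.17628…`) with `k` nonzero coefficients
has `|c_j| < 1.17629 · binom(k-1, j)` (`natAbs_coeff_lt_choose_of_subLehmer`); with the cell's `SparseSubLehmer` (`k ≥ 5`)
the first open sparse class is the PENTANOMIALS, whose coefficients are therefore at most `7` in modulus, the second and
fourth at most `4` (`natAbs_coeff_le_seven_of_subLehmer`, `natAbs_coeff_le_four_of_subLehmer`) — finiteness-type
constraints on the Lehmer ticket, not new bounds on `M`.
-/

namespace Summit.Ventures.DiscreteObjects.Mahler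

open Polynomial

/-! ### Two more bookkeeping facts -/

/-- The rank of a member of the support is less than the number of nonzero coefficients (any coefficients). -/
theorem rank_lt_card_support {R : Type*} [Semiring R] {f : R[X]} {i : ℕ} (hi : i ∈ f.support) :
    (f.support.filter (· < i)).card < f.support.card :=
  Finset.card_lt_card (Finset.filter_ssubset.2 ⟨i, hi, lt_irrefl i⟩)

/-- If `g(0) ≠ 0`: the rank of `i` in the support of `g'` is one less than the rank of `i + 1` in the support of `g`. -/
theorem rank_derivative_succ (g : ℂ[X]) (h0 : g.coeff 0 ≠ 0) (i : ℕ) :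
    (g.derivative.support.filter (· < i)).card + 1 = (g.support.filter (· < i + 1)).card := by
  rw [support_eq_insert_map_derivative g h0, Finset.filter_insert, if_pos (Nat.succ_pos i),
    Finset.card_insert_of_notMem (by simp), Finset.filter_map, Finset.card_map]
  congr 2
  apply Finset.filter_congr
  intro e _
  simp only [Function.comp_apply, Function.Embedding.coeFn_mk]
  omega

/-! ### The inductive step -/

/-- From the derivative: for `g(0) ≠ 0` with `k` nonzero coefficients and `i ∈ supp g`, `i > 0`, of rank `j`:
`i · |c_i| ≤ binom(k-2, j-1) · deg g · M(g)`, given the theorem for `k - 1` nonzero coefficients. -/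
theorem natCast_mul_norm_coeff_le {k : ℕ}
    (ih : ∀ m < k, ∀ p : ℂ[X], p.support.card = m → ∀ i ∈ p.support,
      ‖p.coeff i‖ ≤ ((m - 1).choose ((p.support.filter (· < i)).card) : ℝ) * p.mahlerMeasure)
    (g : ℂ[X]) (hg0 : g.coeff 0 ≠ 0) (hcard : g.support.card = k) {i : ℕ} (hi : i ∈ g.support) (hipos : 0 < i) :
    (i : ℝ) * ‖g.coeff i‖ ≤
      ((k - 2).choose ((g.support.filter (· < i)).card - 1) : ℝ) * (g.natDegree * g.mahlerMeasure) := by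
  obtain ⟨j, rfl⟩ : ∃ j, i = j + 1 := ⟨i - 1, by omega⟩
  have hcard' : g.derivative.support.card = k - 1 := by
    have := card_support_derivative_add_one g hg0
    omega
  have hmem : j ∈ g.derivative.support := mem_support_derivative.2 hi
  have hrank : (g.derivative.support.filter (· < j)).card = (g.support.filter (· < j + 1)).card - 1 := by
    have := rank_derivative_succ g hg0 j
    omega
  have hk1 : 1 ≤ k := by
    rw [← hcard]
    exact Finset.card_pos.2 ⟨_, hi⟩
  have h1 := ih (k - 1) (by omega) g.derivative hcard' j hmem
  have e : k - 1 - 1 = k - 2 := by omega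
  rw [hrank, coeff_derivative, norm_mul, e] at h1
  have hcast : ‖((j : ℂ) + 1)‖ = (j : ℝ) + 1 := by
    have := Complex.norm_natCast (j + 1)
    push_cast at this
    exact this
  rw [hcast] at h1
  have h2 : g.derivative.mahlerMeasure ≤ g.natDegree * g.mahlerMeasure := mahlerMeasure_derivative_le g
  calc ((j + 1 : ℕ) : ℝ) * ‖g.coeff (j + 1)‖ = ‖g.coeff (j + 1)‖ * ((j : ℝ) + 1) := by push_cast; ring
    _ ≤ ((k - 2).choose ((g.support.filter (· < j + 1)).card - 1) : ℝ) * g.derivative.mahlerMeasure := h1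
    _ ≤ ((k - 2).choose ((g.support.filter (· < j + 1)).card - 1) : ℝ) * (g.natDegree * g.mahlerMeasure) :=
        mul_le_mul_of_nonneg_left h2 (by positivity)

/-- The theorem for `g` with `g(0) ≠ 0`, given the theorem for fewer nonzero coefficients. -/
theorem norm_coeff_le_choose_of_coeff_zero_ne {k : ℕ}
    (ih : ∀ m < k, ∀ p : ℂ[X], p.support.card = m → ∀ i ∈ p.support,
      ‖p.coeff i‖ ≤ ((m - 1).choose ((p.support.filter (· < i)).card) : ℝ) * p.mahlerMeasure)
    (g : ℂ[X]) (hg0 : g.coeff 0 ≠ 0) (hcard : g.support.card = k) {i : ℕ} (hi : i ∈ g.support) :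
    ‖g.coeff i‖ ≤ ((k - 1).choose ((g.support.filter (· < i)).card) : ℝ) * g.mahlerMeasure := by
  set r := (g.support.filter (· < i)).card with hr
  set N := g.natDegree with hN
  have hg : g ≠ 0 := fun h => hg0 (by rw [h, coeff_zero])
  have hM : 0 ≤ g.mahlerMeasure := mahlerMeasure_nonneg g
  have hiN : i ≤ N := le_natDegree_of_mem_supp i hi
  have hpart := rank_add_rank_above_add_one hi
  -- the constant coefficient (rank 0)
  rcases Nat.eq_zero_or_pos i with hi0 | hipos
  · have hr0 : r = 0 := by
      rw [hr, Finset.card_eq_zero, hi0]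
      ext e
      simp
    rw [hr0, Nat.choose_zero_right, Nat.cast_one, one_mul, hi0]
    have := norm_coeff_le_choose_mul_mahlerMeasure 0 g
    simpa using this
  -- the leading coefficient (rank `k - 1`)
  rcases hiN.eq_or_lt with hiN' | hiN'
  · have ha0 : (g.support.filter (i < ·)).card = 0 := by
      rw [Finset.card_eq_zero]
      ext e
      simp only [Finset.mem_filter, Finset.notMem_empty, iff_false, not_and, not_lt]
      intro he
      rw [hiN']
      exact le_natDegree_of_mem_supp e he
    have hrk : r = k - 1 := by rw [hr]; omega
    rw [hrk, Nat.choose_self, Nat.cast_one, one_mul, hiN', hN]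
    have := norm_coeff_le_choose_mul_mahlerMeasure g.natDegree g
    simpa using this
  -- a middle coefficient: `0 < i < N`, rank `1 ≤ r ≤ k - 2`
  have hr1 : 1 ≤ r := by
    rw [hr]
    apply Finset.card_pos.2
    exact ⟨0, Finset.mem_filter.2 ⟨mem_support_iff.2 hg0, hipos⟩⟩
  have ha1 : 1 ≤ (g.support.filter (i < ·)).card := by
    apply Finset.card_pos.2
    refine ⟨N, Finset.mem_filter.2 ⟨?_, hiN'⟩⟩
    rw [mem_support_iff, hN, coeff_natDegree]
    exact leadingCoeff_ne_zero.2 hg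
  have hrk : r ≤ k - 2 := by omega
  have hk3 : 3 ≤ k := by omega
  -- (1) from `g'`
  have h1 := natCast_mul_norm_coeff_le ih g hg0 hcard hi hipos
  rw [← hr] at h1
  -- (2) from `(reverse g)'`
  have htr : g.natTrailingDegree = 0 := Nat.le_zero.1 (natTrailingDegree_le_of_ne_zero hg0)
  have hrn : g.reverse.natDegree = N := by rw [reverse_natDegree, htr, Nat.sub_zero]
  have hr0 : g.reverse.coeff 0 ≠ 0 := by
    rw [coeff_zero_reverse]
    exact leadingCoeff_ne_zero.2 hg
  have hrc : g.reverse.coeff (N - i) = g.coeff i := by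
    rw [coeff_reverse, revAt_le (Nat.sub_le N i), Nat.sub_sub_self hiN]
  have hmem' : N - i ∈ g.reverse.support := by
    rw [mem_support_iff, hrc]
    exact mem_support_iff.1 hi
  have hrank' : (g.reverse.support.filter (· < N - i)).card = (g.support.filter (i < ·)).card :=
    rank_reverse g i hiN
  have h2 := natCast_mul_norm_coeff_le ih g.reverse hr0 ((card_support_reverse g).trans hcard) hmem' (by omega)
  rw [hrank', hrc, hrn, mahlerMeasure_reverse, show (g.support.filter (i < ·)).card - 1 = k - 2 - r by omega,
    Nat.choose_symm hrk, Nat.cast_sub hiN] at h2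
  -- add, with Pascal's rule
  have hpas : ((k - 1).choose r : ℝ) = ((k - 2).choose (r - 1) : ℝ) + ((k - 2).choose r : ℝ) := by
    have := Nat.choose_succ_succ' (k - 2) (r - 1)
    rw [show k - 2 + 1 = k - 1 by omega, show r - 1 + 1 = r by omega] at this
    exact_mod_cast this
  have hNpos : (0 : ℝ) < N := by exact_mod_cast (lt_of_lt_of_le hipos hiN)
  have key : (N : ℝ) * ‖g.coeff i‖ ≤ (N : ℝ) * (((k - 1).choose r : ℝ) * g.mahlerMeasure) := by
    have := add_le_add h1 h2
    rw [hpas]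
    nlinarith
  exact le_of_mul_le_mul_left key hNpos

/-- **Akhtari–Vaaler / McKee–Smyth Theorem 11.4 (complex coefficients):** if `f ∈ ℂ[X]` has `k` nonzero coefficients
`c_0, …, c_{k-1}` (by increasing exponent) then `|c_j| ≤ binom(k-1, j) · M(f)`; here `i ∈ supp f` has rank
`j = #{e ∈ supp f : e < i}`.  REPLICATION of [cite: AkhtariVaaler2019, Theorem 1.1] (= [cite: MckeeSmyth2021, Theorem 11.4]). -/
theorem norm_coeff_le_choose_mul_mahlerMeasure (f : ℂ[X]) {i : ℕ} (hi : i ∈ f.support) :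
    ‖f.coeff i‖ ≤ ((f.support.card - 1).choose ((f.support.filter (· < i)).card) : ℝ) * f.mahlerMeasure := by
  suffices H : ∀ k : ℕ, ∀ f : ℂ[X], f.support.card = k → ∀ i ∈ f.support,
      ‖f.coeff i‖ ≤ ((k - 1).choose ((f.support.filter (· < i)).card) : ℝ) * f.mahlerMeasure from H _ f rfl i hi
  intro k
  induction k using Nat.strong_induction_on with
  | _ k ih =>
  intro f hk i hi
  have hfi : f.coeff i ≠ 0 := mem_support_iff.1 hi
  have hf : f ≠ 0 := fun h => hfi (by rw [h, coeff_zero])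
  obtain ⟨g, hfg, hndvd⟩ := exists_eq_pow_rootMultiplicity_mul_and_not_dvd f hf 0
  simp only [map_zero, sub_zero] at hfg hndvd
  set r := rootMultiplicity 0 f with hr
  have hg0 : g.coeff 0 ≠ 0 := fun h => hndvd (X_dvd_iff.2 h)
  have hcard : g.support.card = k := by rw [← hk, hfg, card_support_X_pow_mul_complex]
  have hri : r ≤ i := by
    by_contra hlt
    push Not at hlt
    apply hfi
    rw [hfg, coeff_X_pow_mul', if_neg (not_le.2 hlt)]
  have hcoef : f.coeff i = g.coeff (i - r) := by rw [hfg, coeff_X_pow_mul', if_pos hri]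
  have hi' : i - r ∈ g.support := by
    rw [mem_support_iff, ← hcoef]
    exact hfi
  have hrank : (f.support.filter (· < i)).card = (g.support.filter (· < i - r)).card := by
    rw [hfg, ← rank_X_pow_mul r g (i - r), Nat.sub_add_cancel hri]
  rw [hcoef, hrank, hfg, mahlerMeasure_X_pow_mul]
  exact norm_coeff_le_choose_of_coeff_zero_ne ih g hg0 hcard hi'

/-- **Dobrowolski–Smyth 2017, Theorem 1 (complex coefficients, coefficientwise):** every coefficient of `f ∈ ℂ[X]`
with `k` nonzero coefficients satisfies `|a_i| ≤ 2^{k-2} · M(f)` (exponent in `ℕ`; `binom(k-1, j) ≤ 2^{k-2}`).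
Equivalently `M(f) ≥ h(f)/2^{k-2}`.  REPLICATION of [cite: DobrowolskiSmyth2017, Theorem 1]. -/
theorem norm_coeff_le_two_pow_mul_mahlerMeasure (f : ℂ[X]) (i : ℕ) :
    ‖f.coeff i‖ ≤ 2 ^ (f.support.card - 2) * f.mahlerMeasure := by
  have hM : 0 ≤ f.mahlerMeasure := mahlerMeasure_nonneg f
  by_cases hi : i ∈ f.support
  · refine (norm_coeff_le_choose_mul_mahlerMeasure f hi).trans (mul_le_mul_of_nonneg_right ?_ hM)
    have hk : 1 ≤ f.support.card := Finset.card_pos.2 ⟨i, hi⟩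
    rcases hk.eq_or_lt with hk1 | hk2
    · rw [← hk1]
      have : (f.support.filter (· < i)).card = 0 := by
        have := rank_lt_card hi
        omega
      rw [this]
      norm_num
    · have h := choose_le_two_pow_pred (n := f.support.card - 1) (by omega) ((f.support.filter (· < i)).card)
      rw [show f.support.card - 1 - 1 = f.support.card - 2 by omega] at h
      exact_mod_cast h
  · rw [notMem_support_iff.1 hi, norm_zero]
    positivity

/-! ### Integer coefficients: the Literature named fact, and the census reading -/

/-- Cast bookkeeping: `natAbs` of an integer is the modulus of its image in `ℂ`. -/
theorem natAbs_cast_eq_norm_intCast (m : ℤ) : ((m.natAbs : ℕ) : ℝ) = ‖((m : ℤ) : ℂ)‖ := by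
  rw [Complex.norm_intCast, ← Int.cast_natCast, Int.natCast_natAbs, Int.cast_abs]

/-- Akhtari–Vaaler for integer polynomials: `|c_j| ≤ binom(k-1, j) · M(f)` (`j` = rank of the exponent `i`). -/
theorem natAbs_coeff_le_choose_mul_mahlerMeasure (f : ℤ[X]) {i : ℕ} (hi : i ∈ f.support) :
    ((f.coeff i).natAbs : ℝ) ≤
      ((f.support.card - 1).choose ((f.support.filter (· < i)).card) : ℝ) * (f.map (Int.castRingHom ℂ)).mahlerMeasure := by
  have hs : (f.map (Int.castRingHom ℂ)).support = f.support := support_map_of_injective _ (RingHom.injective_int _)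
  have h := norm_coeff_le_choose_mul_mahlerMeasure (f.map (Int.castRingHom ℂ)) (i := i) (by rw [hs]; exact hi)
  rw [hs, coeff_map] at h
  rw [natAbs_cast_eq_norm_intCast]
  exact h

/-- Dobrowolski–Smyth for integer polynomials, coefficientwise: `|a_i| ≤ 2^{k-2} M(f)`. -/
theorem natAbs_coeff_le_two_pow_mul_mahlerMeasure (f : ℤ[X]) (i : ℕ) :
    ((f.coeff i).natAbs : ℝ) ≤ 2 ^ (f.support.card - 2) * (f.map (Int.castRingHom ℂ)).mahlerMeasure := by
  have h := norm_coeff_le_two_pow_mul_mahlerMeasure (f.map (Int.castRingHom ℂ)) i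
  rw [support_map_of_injective _ (RingHom.injective_int _), coeff_map] at h
  rw [natAbs_cast_eq_norm_intCast]
  exact h

open Literature.NumberTheory.MahlerMeasure in
/-- **DISCHARGE of the Literature named fact** `FewnomialHeightMahlerBound` [cite: DobrowolskiSmyth2017, Theorem 1]
(integer case): a nonzero `f ∈ ℤ[z]` with `k ≥ 2` nonzero coefficients has `M(f) ≥ h(f)/2^{k-2}`. -/
theorem fewnomialHeightMahlerBound_holds : FewnomialHeightMahlerBound := by
  intro f hk
  have hne : f.support.Nonempty := by
    rw [← Finset.card_pos]
    omega
  obtain ⟨i₀, -, hsup⟩ := Finset.exists_mem_eq_sup f.support hne (fun i => (f.coeff i).natAbs)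
  rw [hsup, div_le_iff₀ (by positivity), mul_comm]
  exact natAbs_coeff_le_two_pow_mul_mahlerMeasure f i₀

/-- **Census reading (target L):** a sub-Lehmer integer polynomial with `k` nonzero coefficients has
`|c_j| < 1.17629 · binom(k-1, j)` for its coefficient of rank `j`. -/
theorem natAbs_coeff_lt_choose_of_subLehmer {P : ℤ[X]} (hP : SubLehmer P) {i : ℕ} (hi : i ∈ P.support) :
    ((P.coeff i).natAbs : ℝ) < 117629 / 100000 * ((P.support.card - 1).choose ((P.support.filter (· < i)).card) : ℝ) := by
  have h := natAbs_coeff_le_choose_mul_mahlerMeasure P hi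
  have hM : (P.map (Int.castRingHom ℂ)).mahlerMeasure < 117629 / 100000 :=
    lt_trans hP.2 lehmer_measure_upper_bound
  have hc : (0 : ℝ) < ((P.support.card - 1).choose ((P.support.filter (· < i)).card) : ℝ) := by
    have := Nat.choose_pos (n := P.support.card - 1) (k := (P.support.filter (· < i)).card)
      (by have := rank_lt_card_support hi; omega)
    exact_mod_cast this
  calc ((P.coeff i).natAbs : ℝ)
      ≤ ((P.support.card - 1).choose ((P.support.filter (· < i)).card) : ℝ) * (P.map (Int.castRingHom ℂ)).mahlerMeasure := h
    _ < ((P.support.card - 1).choose ((P.support.filter (· < i)).card) : ℝ) * (117629 / 100000) :=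
        mul_lt_mul_of_pos_left hM hc
    _ = _ := mul_comm _ _

/-- A sub-Lehmer integer polynomial with `k` nonzero coefficients has height `< 1.17629 · 2^{k-2}`. -/
theorem natAbs_coeff_lt_two_pow_of_subLehmer {P : ℤ[X]} (hP : SubLehmer P) (i : ℕ) :
    ((P.coeff i).natAbs : ℝ) < 117629 / 100000 * 2 ^ (P.support.card - 2) := by
  have h := natAbs_coeff_le_two_pow_mul_mahlerMeasure P i
  have hM : (P.map (Int.castRingHom ℂ)).mahlerMeasure < 117629 / 100000 :=
    lt_trans hP.2 lehmer_measure_upper_bound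
  have hpow : (0 : ℝ) < 2 ^ (P.support.card - 2) := by positivity
  calc ((P.coeff i).natAbs : ℝ) ≤ 2 ^ (P.support.card - 2) * (P.map (Int.castRingHom ℂ)).mahlerMeasure := h
    _ < 2 ^ (P.support.card - 2) * (117629 / 100000) := mul_lt_mul_of_pos_left hM hpow
    _ = 117629 / 100000 * 2 ^ (P.support.card - 2) := mul_comm _ _

/-- **A sub-Lehmer polynomial with at most five nonzero coefficients has all coefficients of modulus at most `7`**
(`1.17629 · binom(4, 2) = 7.06`; by the cell's `SparseSubLehmer` a sub-Lehmer polynomial has at least five nonzero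
coefficients, so this is the pentanomial class). -/
theorem natAbs_coeff_le_seven_of_subLehmer {P : ℤ[X]} (hP : SubLehmer P) (h5 : P.support.card ≤ 5) (i : ℕ) :
    (P.coeff i).natAbs ≤ 7 := by
  by_cases hi : i ∈ P.support
  · have h := natAbs_coeff_lt_choose_of_subLehmer hP hi
    have hr := rank_lt_card_support hi
    have hc : (P.support.card - 1).choose ((P.support.filter (· < i)).card) ≤ 6 := by
      set k := P.support.card with hk
      set r := (P.support.filter (· < i)).card with hr'
      have hrk : r < k := hr
      interval_cases k <;> interval_cases r <;> decide
    have hc' : ((P.support.card - 1).choose ((P.support.filter (· < i)).card) : ℝ) ≤ 6 := by exact_mod_cast hc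
    have h8 : ((P.coeff i).natAbs : ℝ) < 8 := by nlinarith
    have : (P.coeff i).natAbs < 8 := by exact_mod_cast h8
    omega
  · rw [notMem_support_iff.1 hi]
    simp

/-- **… and its coefficients of rank `1` and `3` (the second and fourth) have modulus at most `4`**
(`1.17629 · binom(4, 1) = 4.71`). -/
theorem natAbs_coeff_le_four_of_subLehmer {P : ℤ[X]} (hP : SubLehmer P) (h5 : P.support.card ≤ 5) {i : ℕ}
    (hi : i ∈ P.support) (hrank : (P.support.filter (· < i)).card = 1 ∨ (P.support.filter (· < i)).card = 3) :
    (P.coeff i).natAbs ≤ 4 := by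
  have h := natAbs_coeff_lt_choose_of_subLehmer hP hi
  have hr := rank_lt_card_support hi
  have hc : (P.support.card - 1).choose ((P.support.filter (· < i)).card) ≤ 4 := by
    set k := P.support.card with hk
    set r := (P.support.filter (· < i)).card with hr'
    have hrk : r < k := hr
    rcases hrank with h1 | h3
    · rw [h1]
      interval_cases k <;> decide
    · rw [h3] at hrk ⊢
      interval_cases k <;> decide
  have hc' : ((P.support.card - 1).choose ((P.support.filter (· < i)).card) : ℝ) ≤ 4 := by exact_mod_cast hc
  have h5' : ((P.coeff i).natAbs : ℝ) < 5 := by nlinarith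
  have : (P.coeff i).natAbs < 5 := by exact_mod_cast h5'
  omega

/-- With at most six nonzero coefficients every coefficient of a sub-Lehmer polynomial has modulus at most `11`
(`1.17629 · binom(5, 2) = 11.76`). -/
theorem natAbs_coeff_le_eleven_of_subLehmer {P : ℤ[X]} (hP : SubLehmer P) (h6 : P.support.card ≤ 6) (i : ℕ) :
    (P.coeff i).natAbs ≤ 11 := by
  by_cases hi : i ∈ P.support
  · have h := natAbs_coeff_lt_choose_of_subLehmer hP hi
    have hr := rank_lt_card_support hi
    have hc : (P.support.card - 1).choose ((P.support.filter (· < i)).card) ≤ 10 := by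
      set k := P.support.card with hk
      set r := (P.support.filter (· < i)).card with hr'
      have hrk : r < k := hr
      interval_cases k <;> interval_cases r <;> decide
    have hc' : ((P.support.card - 1).choose ((P.support.filter (· < i)).card) : ℝ) ≤ 10 := by exact_mod_cast hc
    have h12 : ((P.coeff i).natAbs : ℝ) < 12 := by nlinarith
    have : (P.coeff i).natAbs < 12 := by exact_mod_cast h12
    omega
  · rw [notMem_support_iff.1 hi]
    simp

end Summit.Ventures.DiscreteObjects.Mahler
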